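import Literature.MathematicalPhysics.QuantumFieldTheory.Balaban1983to89.B4Eq16GreenExists
import Literature.MathematicalPhysics.QuantumFieldTheory.Balaban1983to89.B4Lemma22ReduceZero

/-!
# [B4] (1.6) on the fine BOXES of Lemma 2.2: `H(□, Ã) = −Δ^{η,N}_{Ã,□} + m² + a_kP_k(Ã)` is invertible FOR EVERY
`Ã` — the invertibility hypothesis `IsUnit (opA …).det` of the Lemma 2.2 chain discharged, and the resolvent
identity (2.31) for `G_k(□, Ã)` without it

T. Bałaban, *Regularity and decay of lattice Green's functions*, Commun. Math. Phys. **89** (1983) 571–597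
[Balaban1983RegularityDecay] (= [B4]; journal page = PDF page + 570).

statement-level skeleton of published theorems with citation tags; proofs where landed; nothing here is a claim about the Yang–Mills mass gap

PDF held: `paper:balaban1983-cmp89-regularity-decay` (p. 572 [PDF 2] and p. 581 [PDF 11] read this session).

WHAT IS REPRODUCED = SKELETON rows **B4.Eq1.6** (the operator (1.6) on the boxes `□` of Lemma 2.2) and **B4.Eq2.31**
((2.31) p. 581 «G_k(□,Ã) = Σ_{n=0}^∞ G_k(□,A₀)(V_kG_k(□,A₀))^n», in the resolvent form certified by the lineage),
unit `lit-balaban-p35` gen 4 (Phase-2 proof seat; HOME `run/shared/lean/pub/lit-balaban/`), companion of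
`B4Eq16GreenExists` (same seat).  The print, p. 572: «Our fundamental Green's function is a kernel of the operator
(1.6) `G_k(Ω, A) = (−Δ^{η,N}_{A,Ω} + m² + aP_k(A))^{−1}`, where `m² ≥ 0` and `a` is a positive constant close to 1.»

CONTEXT.  The Lemma 2.2 files of the `B4*` lineage (`B4Lemma22ReduceZero`, `B4Lemma22ReduceDeriv`,
`B4Lemma22PertVSup`, `B4Lemma22LpStair`, `B4Lemma22LpLqTransfer`, `B4Lemma22HolderBox`, …) state their headline
theorems for [B4]'s operator on the fine box `□ = Box d ℓ k M` at the field `Ã = A₀ + A′`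
(`B4Lemma22ReduceZero.opA`, an `abbrev` for `B4GaugeCovariance.b4Op` with the box weights `boxWt`/`blkWt` and the
running coefficient `a_k = B1.aSeq a L k`) under the HYPOTHESIS `IsUnit (opA … (A₀ + A′)).det` — «the invertibility
of `H(□,Ã)` is a hypothesis (on the window with the staircase contours and (1.7)-regular `Ã` it is
`B4Lower18Regular.green_box_l2_bound`)» (docstring of `B4Lemma22ReduceZero.greenA_resolvent`); the staircase
specialisations (`…_stair`) discharge it through an extra smallness condition
`ℓ₁²θ²(d+1)(1 + a_k(d+1)) ≤ min(2,a_k)/4`.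

WHAT IS PROVED HERE (0 sorry, standard axioms, no new definitions): by the zero-mode analysis of
`B4Eq16GreenExists` (the form (1.3)+(1.5) vanishes only on covariantly constant fields with vanishing covariant
block averages, and those vanish) the operator is POSITIVE DEFINITE, hence invertible, for EVERY bond field — no
regularity, no smallness, any coupling `κ`, any orthogonal one-parameter flow, `m² ≥ 0`:
* §1 (box family of `B4Lower18Regular`/`B4GaugeCovariance` §7: fine box `boxDom (n·M)`, weights `boxWt`, `blkWt`,
  coefficient `a_k·n^{−(d+1)}`): `b4Op_box_posDef` / `b4Op_box_isUnit` for EVERY contour system whose weighted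
  contours consist of nearest-neighbour steps and end at their target (the hypotheses `hnn`/`hend` the lineage
  already uses), and `b4Op_box_stair_posDef` / `b4Op_box_stair_isUnit` for [B4]'s staircase contours
  (`baseEmb`, `stairContour`) with NO contour hypothesis.
* §2 (the Lemma 2.2 operator): **`opA_posDef`**, **`opA_isUnit_det`** (every `A`, every admissible contour system,
  `a > 0`, `m² ≥ 0`, `ℓ, k ≥ 1`), `opA_stair_isUnit_det` (staircase contours), `greenA_mul_opA` / `opA_mul_greenA`
  (`G_k(□,Ã)` is the two-sided inverse), and **`greenA_resolvent_all`** = `B4Lemma22ReduceZero.greenA_resolvent`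
  ((2.31) in resolvent form, `G_k(□,Ã) = G_k(□,A₀) + G_k(□,A₀)·V·G_k(□,Ã)`) with its hypothesis `hunit` DISCHARGED
  for every `Ã = A₀ + A′` (one extra input: the contour steps are nearest neighbours, `hnn`).

HONEST SCOPE.  (a) Qualitative invertibility only; the uniform bounds of Lemma 2.2 are untouched (they need the
smallness of `V_k`, i.e. regularity).  (b) The headline theorems of the Lemma 2.2 files keep their printed-shape
hypothesis lists; this file supplies the term that instantiates `IsUnit (opA …).det` (and shows the staircase files'
extra smallness condition is needed only for their quantitative constant, not for existence).  (c) Geometry and link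
variables as in the lineage (fine boxes of `ℤ^{d+1}`, one orthogonal one-parameter group).  (d) That (1.6) is
invertible for non-regular `A` is our elementary remark, not a statement printed in [B4] (which considers these
operators «under the assumption that the vector field A is regular», p. 572).
-/

namespace Literature.MathematicalPhysics.QuantumFieldTheory.Balaban1983to89.B4Lemma22Invertible

open Matrix Finset
open Literature.MathematicalPhysics.QuantumFieldTheory.Balaban1983to89.B4GaugeCovariance
open Literature.MathematicalPhysics.QuantumFieldTheory.Balaban1983to89.B4Lower18Regular
  (PathRel baseEmb stairContour stairContour_end stairContour_nn)
open Literature.MathematicalPhysics.QuantumFieldTheory.Balaban1983to89.B4Lower18RegularRegion (pathRel_mono)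
open Literature.MathematicalPhysics.QuantumFieldTheory.Balaban1983to89.B4Reflection242 (boxDom blk nbrs blk_mem_boxDom)
open Literature.MathematicalPhysics.QuantumFieldTheory.Balaban1983to89.B4Eq16GreenExists
open Literature.MathematicalPhysics.QuantumFieldTheory.Balaban1983to89.B4Lemma22ReduceZero (Box opA greenA greenA0 pertV)

/-! ## §1 The fine boxes of the lineage: every contour system with nearest-neighbour steps; the staircase system -/

section BoxFamily

variable {d : ℕ} {ι : Type*} [Fintype ι] [DecidableEq ι]

/-- the Neumann bond weights of a box are non-negative (private plumbing). [folklore] -/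
private theorem boxWt_nonneg' (n : ℕ) (N : Fin (d + 1) → ℕ) (x y : ↥(boxDom N)) : 0 ≤ boxWt n N x y := by
  unfold boxWt; split_ifs <;> positivity

/-- the block weights of a box are non-negative (private plumbing). [folklore] -/
private theorem blkWt_nonneg' (n : ℕ) (M N : Fin (d + 1) → ℕ) (y : ↥(boxDom M)) (x : ↥(boxDom N)) :
    0 ≤ blkWt n M N y x := by
  unfold blkWt; split_ifs <;> norm_num

/-- every fine point `x` of the box `□ = {0 ≤ x_μ < nM_μ}` lies in the `n`-block of its label `blk n x ∈ {0 ≤ y_μ < M_μ}`,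
with block weight `1`. [cite: Balaban1983RegularityDecay, p. 572 (1.1), (1.4)] -/
theorem blkWt_cover {n : ℕ} (hn : 1 ≤ n) (M : Fin (d + 1) → ℕ) (x : ↥(boxDom (fun i => n * M i))) :
    ∃ y : ↥(boxDom M), 0 < blkWt n M (fun i => n * M i) y x :=
  ⟨⟨blk n x.1, blk_mem_boxDom hn x.2⟩, by simp [blkWt]⟩

/-- nearest-neighbour steps inside the box carry the positive Neumann weight `n²/2`.
[cite: Balaban1983RegularityDecay, p. 572 (1.3)] -/
theorem pathRel_boxWt_of_nn {n : ℕ} (hn : 1 ≤ n) (N : Fin (d + 1) → ℕ) {x : ↥(boxDom N)} {l : List ↥(boxDom N)}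
    (h : PathRel (fun u v : ↥(boxDom N) => v.1 ∈ nbrs u.1) x l) :
    PathRel (fun u v : ↥(boxDom N) => 0 < boxWt n N u v) x l := by
  refine pathRel_mono (fun u v huv => ?_) _ _ h
  have hn' : (0 : ℝ) < n := by exact_mod_cast hn
  simp only [boxWt, if_pos huv, mul_one]
  positivity

/-- **(1.6) ON A FINE BOX IS POSITIVE DEFINITE FOR EVERY CONFIGURATION `A`**, for every contour system whose weighted
contours `Γ_{y,x}` consist of nearest-neighbour steps (`hnn`) and end at `x` (`hend`); `a_k > 0`, `m² ≥ 0`.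
[cite: Balaban1983RegularityDecay, p. 572 (1.6)] -/
theorem b4Op_box_posDef (F : OrthFlow ι) (κ : ℝ) {n : ℕ} (hn : 1 ≤ n) {ak : ℝ} (hak : 0 < ak) {m2 : ℝ}
    (hm : 0 ≤ m2) (M : Fin (d + 1) → ℕ) {emb : ↥(boxDom M) → ↥(boxDom (fun i => n * M i))}
    {Γ : ↥(boxDom M) → ↥(boxDom (fun i => n * M i)) → List ↥(boxDom (fun i => n * M i))}
    (hnn : ∀ y x, blkWt n M (fun i => n * M i) y x ≠ 0 →
      PathRel (fun u v : ↥(boxDom (fun i => n * M i)) => v.1 ∈ nbrs u.1) (emb y) (Γ y x))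
    (hend : ∀ y x, blkWt n M (fun i => n * M i) y x ≠ 0 → pathEnd (emb y) (Γ y x) = x)
    (A : ↥(boxDom (fun i => n * M i)) → ↥(boxDom (fun i => n * M i)) → ℝ) :
    (b4Op F κ (boxWt n (fun i => n * M i)) m2 (ak * ((n : ℝ) ^ (d + 1))⁻¹) (blkWt n M (fun i => n * M i))
      emb Γ A).PosDef := by
  have hn' : (0 : ℝ) < n := by exact_mod_cast hn
  exact b4Op_posDef F κ (boxWt_nonneg' n _) hm (by positivity) (blkWt_nonneg' n M _) (blkWt_cover hn M)
    (fun y x h => pathRel_boxWt_of_nn hn _ (hnn y x h)) hend A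

/-- … hence INVERTIBLE, for every `A`. [cite: Balaban1983RegularityDecay, p. 572 (1.6)] -/
theorem b4Op_box_isUnit (F : OrthFlow ι) (κ : ℝ) {n : ℕ} (hn : 1 ≤ n) {ak : ℝ} (hak : 0 < ak) {m2 : ℝ}
    (hm : 0 ≤ m2) (M : Fin (d + 1) → ℕ) {emb : ↥(boxDom M) → ↥(boxDom (fun i => n * M i))}
    {Γ : ↥(boxDom M) → ↥(boxDom (fun i => n * M i)) → List ↥(boxDom (fun i => n * M i))}
    (hnn : ∀ y x, blkWt n M (fun i => n * M i) y x ≠ 0 →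
      PathRel (fun u v : ↥(boxDom (fun i => n * M i)) => v.1 ∈ nbrs u.1) (emb y) (Γ y x))
    (hend : ∀ y x, blkWt n M (fun i => n * M i) y x ≠ 0 → pathEnd (emb y) (Γ y x) = x)
    (A : ↥(boxDom (fun i => n * M i)) → ↥(boxDom (fun i => n * M i)) → ℝ) :
    IsUnit (b4Op F κ (boxWt n (fun i => n * M i)) m2 (ak * ((n : ℝ) ^ (d + 1))⁻¹) (blkWt n M (fun i => n * M i))
      emb Γ A) :=
  (b4Op_box_posDef F κ hn hak hm M hnn hend A).isUnit

/-- **(1.6) ON A FINE BOX WITH [B4]'s STAIRCASE CONTOURS IS POSITIVE DEFINITE FOR EVERY `A`** — no contour hypothesis.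
[cite: Balaban1983RegularityDecay, p. 572 (1.6), (1.4)] -/
theorem b4Op_box_stair_posDef (F : OrthFlow ι) (κ : ℝ) {n : ℕ} (hn : 1 ≤ n) {ak : ℝ} (hak : 0 < ak) {m2 : ℝ}
    (hm : 0 ≤ m2) (M : Fin (d + 1) → ℕ) (A : ↥(boxDom (fun i => n * M i)) → ↥(boxDom (fun i => n * M i)) → ℝ) :
    (b4Op F κ (boxWt n (fun i => n * M i)) m2 (ak * ((n : ℝ) ^ (d + 1))⁻¹) (blkWt n M (fun i => n * M i))
      (baseEmb hn M) (stairContour hn M) A).PosDef :=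
  b4Op_box_posDef F κ hn hak hm M (fun y x _ => stairContour_nn hn M y x) (fun y x h => stairContour_end hn M y x h) A

/-- … hence INVERTIBLE, for every `A`. [cite: Balaban1983RegularityDecay, p. 572 (1.6), (1.4)] -/
theorem b4Op_box_stair_isUnit (F : OrthFlow ι) (κ : ℝ) {n : ℕ} (hn : 1 ≤ n) {ak : ℝ} (hak : 0 < ak) {m2 : ℝ}
    (hm : 0 ≤ m2) (M : Fin (d + 1) → ℕ) (A : ↥(boxDom (fun i => n * M i)) → ↥(boxDom (fun i => n * M i)) → ℝ) :
    IsUnit (b4Op F κ (boxWt n (fun i => n * M i)) m2 (ak * ((n : ℝ) ^ (d + 1))⁻¹) (blkWt n M (fun i => n * M i))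
      (baseEmb hn M) (stairContour hn M) A) :=
  (b4Op_box_stair_posDef F κ hn hak hm M A).isUnit

end BoxFamily

/-! ## §2 The operator `H(□, Ã)` of the Lemma 2.2 chain (`B4Lemma22ReduceZero.opA`): invertible for every `Ã` -/

section Lemma22

variable {d : ℕ} {ι : Type} [Fintype ι] [DecidableEq ι]

/-- the running coefficient is positive and the box is at least one point wide (private plumbing). [folklore] -/
private theorem aSeq_pos_of {ℓ k : ℕ} (hℓ : 1 ≤ ℓ) (hk : 1 ≤ k) {a : ℝ} (ha : 0 < a) :
    0 < B1.aSeq a ((ℓ : ℝ) + 1) k := by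
  have hL : (1 : ℝ) < (ℓ : ℝ) + 1 := by
    have : (1 : ℝ) ≤ (ℓ : ℝ) := by exact_mod_cast hℓ
    linarith
  exact B1.aSeq_pos ha hL hk

/-- **`H(□, A) = −Δ^{η,N}_{A,□} + m² + a_kP_k(A)` IS POSITIVE DEFINITE FOR EVERY `A`** on the fine box of the
Lemma 2.2 chain, for every contour system with nearest-neighbour steps ending at their targets (`ℓ, k ≥ 1`, `a > 0`,
`m² ≥ 0`; any `κ`, any orthogonal flow). [cite: Balaban1983RegularityDecay, p. 572 (1.6); p. 581 (2.31)] -/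
theorem opA_posDef (F : OrthFlow ι) (κ : ℝ) {ℓ k : ℕ} (hℓ : 1 ≤ ℓ) (hk : 1 ≤ k) {a m2 : ℝ} (ha : 0 < a)
    (hm : 0 ≤ m2) (M : Fin (d + 1) → ℕ) {emb : ↥(boxDom M) → ↥(Box d ℓ k M)}
    {Γ : ↥(boxDom M) → ↥(Box d ℓ k M) → List ↥(Box d ℓ k M)}
    (hnn : ∀ y x, blkWt ((ℓ + 1) ^ k) M (fun i => (ℓ + 1) ^ k * M i) y x ≠ 0 →
      PathRel (fun u v : ↥(Box d ℓ k M) => v.1 ∈ nbrs u.1) (emb y) (Γ y x))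
    (hend : ∀ y x, blkWt ((ℓ + 1) ^ k) M (fun i => (ℓ + 1) ^ k * M i) y x ≠ 0 → pathEnd (emb y) (Γ y x) = x)
    (A : ↥(Box d ℓ k M) → ↥(Box d ℓ k M) → ℝ) : (opA d F κ ℓ k a m2 M emb Γ A).PosDef := by
  have hn : 1 ≤ (ℓ + 1) ^ k := Nat.one_le_pow _ _ (Nat.succ_pos ℓ)
  exact b4Op_box_posDef F κ hn (aSeq_pos_of hℓ hk ha) hm M hnn hend A

/-- **THE INVERTIBILITY HYPOTHESIS OF THE LEMMA 2.2 CHAIN HOLDS FOR EVERY CONFIGURATION**: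
`IsUnit (H(□, A)).det` for every bond field `A` (in particular every `Ã = A₀ + A′`, regular or not).
[cite: Balaban1983RegularityDecay, p. 572 (1.6); p. 581 (2.31)] -/
theorem opA_isUnit_det (F : OrthFlow ι) (κ : ℝ) {ℓ k : ℕ} (hℓ : 1 ≤ ℓ) (hk : 1 ≤ k) {a m2 : ℝ} (ha : 0 < a)
    (hm : 0 ≤ m2) (M : Fin (d + 1) → ℕ) {emb : ↥(boxDom M) → ↥(Box d ℓ k M)}
    {Γ : ↥(boxDom M) → ↥(Box d ℓ k M) → List ↥(Box d ℓ k M)}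
    (hnn : ∀ y x, blkWt ((ℓ + 1) ^ k) M (fun i => (ℓ + 1) ^ k * M i) y x ≠ 0 →
      PathRel (fun u v : ↥(Box d ℓ k M) => v.1 ∈ nbrs u.1) (emb y) (Γ y x))
    (hend : ∀ y x, blkWt ((ℓ + 1) ^ k) M (fun i => (ℓ + 1) ^ k * M i) y x ≠ 0 → pathEnd (emb y) (Γ y x) = x)
    (A : ↥(Box d ℓ k M) → ↥(Box d ℓ k M) → ℝ) : IsUnit (opA d F κ ℓ k a m2 M emb Γ A).det :=
  (Matrix.isUnit_iff_isUnit_det _).1 (opA_posDef F κ hℓ hk ha hm M hnn hend A).isUnit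

/-- the same for [B4]'s STAIRCASE contours `Γ_{y,x}` from the base corner `n·y` (`B4Lower18Regular.stairContour`):
`IsUnit (H(□, A)).det` for every `A`, NO further hypothesis. [cite: Balaban1983RegularityDecay, p. 572 (1.6), (1.4)] -/
theorem opA_stair_isUnit_det (F : OrthFlow ι) (κ : ℝ) {ℓ k : ℕ} (hℓ : 1 ≤ ℓ) (hk : 1 ≤ k)
    (hn : 1 ≤ (ℓ + 1) ^ k) {a m2 : ℝ} (ha : 0 < a) (hm : 0 ≤ m2) (M : Fin (d + 1) → ℕ)
    (A : ↥(Box d ℓ k M) → ↥(Box d ℓ k M) → ℝ) :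
    IsUnit (opA d F κ ℓ k a m2 M (baseEmb hn M) (stairContour hn M) A).det :=
  opA_isUnit_det F κ hℓ hk ha hm M (fun y x _ => stairContour_nn hn M y x)
    (fun y x h => stairContour_end hn M y x h) A

/-- **`G_k(□, A)·H(□, A) = 1` FOR EVERY `A`** (`B4Lemma22ReduceZero.greenA`).
[cite: Balaban1983RegularityDecay, p. 572 (1.6)] -/
theorem greenA_mul_opA (F : OrthFlow ι) (κ : ℝ) {ℓ k : ℕ} (hℓ : 1 ≤ ℓ) (hk : 1 ≤ k) {a m2 : ℝ} (ha : 0 < a)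
    (hm : 0 ≤ m2) (M : Fin (d + 1) → ℕ) {emb : ↥(boxDom M) → ↥(Box d ℓ k M)}
    {Γ : ↥(boxDom M) → ↥(Box d ℓ k M) → List ↥(Box d ℓ k M)}
    (hnn : ∀ y x, blkWt ((ℓ + 1) ^ k) M (fun i => (ℓ + 1) ^ k * M i) y x ≠ 0 →
      PathRel (fun u v : ↥(Box d ℓ k M) => v.1 ∈ nbrs u.1) (emb y) (Γ y x))
    (hend : ∀ y x, blkWt ((ℓ + 1) ^ k) M (fun i => (ℓ + 1) ^ k * M i) y x ≠ 0 → pathEnd (emb y) (Γ y x) = x)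
    (A : ↥(Box d ℓ k M) → ↥(Box d ℓ k M) → ℝ) :
    greenA d F κ ℓ k a m2 M emb Γ A * opA d F κ ℓ k a m2 M emb Γ A = 1 :=
  Matrix.nonsing_inv_mul _ (opA_isUnit_det F κ hℓ hk ha hm M hnn hend A)

/-- **`H(□, A)·G_k(□, A) = 1` FOR EVERY `A`.** [cite: Balaban1983RegularityDecay, p. 572 (1.6)] -/
theorem opA_mul_greenA (F : OrthFlow ι) (κ : ℝ) {ℓ k : ℕ} (hℓ : 1 ≤ ℓ) (hk : 1 ≤ k) {a m2 : ℝ} (ha : 0 < a)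
    (hm : 0 ≤ m2) (M : Fin (d + 1) → ℕ) {emb : ↥(boxDom M) → ↥(Box d ℓ k M)}
    {Γ : ↥(boxDom M) → ↥(Box d ℓ k M) → List ↥(Box d ℓ k M)}
    (hnn : ∀ y x, blkWt ((ℓ + 1) ^ k) M (fun i => (ℓ + 1) ^ k * M i) y x ≠ 0 →
      PathRel (fun u v : ↥(Box d ℓ k M) => v.1 ∈ nbrs u.1) (emb y) (Γ y x))
    (hend : ∀ y x, blkWt ((ℓ + 1) ^ k) M (fun i => (ℓ + 1) ^ k * M i) y x ≠ 0 → pathEnd (emb y) (Γ y x) = x)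
    (A : ↥(Box d ℓ k M) → ↥(Box d ℓ k M) → ℝ) :
    opA d F κ ℓ k a m2 M emb Γ A * greenA d F κ ℓ k a m2 M emb Γ A = 1 :=
  Matrix.mul_nonsing_inv _ (opA_isUnit_det F κ hℓ hk ha hm M hnn hend A)

/-- **(2.31) FOR [B4]'s GREEN'S FUNCTION, FOR EVERY `Ã = A₀ + A′`**: `G_k(□,Ã) = G_k(□,A₀) + G_k(□,A₀)·V·G_k(□,Ã)`
(`V = B4Lemma22ReduceZero.pertV`, the lineage's typed perturbation of (2.24)) — the lineage's
`B4Lemma22ReduceZero.greenA_resolvent` with its invertibility hypothesis `hunit` DISCHARGED by `opA_isUnit_det`; the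
contour system is any one with nearest-neighbour steps ending at their targets.
[cite: Balaban1983RegularityDecay, (2.31) p. 581; (2.24) p. 580] -/
theorem greenA_resolvent_all (F : OrthFlow ι) (κ : ℝ) {ℓ k : ℕ} (hℓ : 1 ≤ ℓ) (hk : 1 ≤ k) {a m2 : ℝ}
    (ha : 0 < a) (hm : 0 ≤ m2) {M : Fin (d + 1) → ℕ} (hM : ∀ i, 1 ≤ M i) {emb : ↥(boxDom M) → ↥(Box d ℓ k M)}
    {Γ : ↥(boxDom M) → ↥(Box d ℓ k M) → List ↥(Box d ℓ k M)}
    (hnn : ∀ y x, blkWt ((ℓ + 1) ^ k) M (fun i => (ℓ + 1) ^ k * M i) y x ≠ 0 →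
      PathRel (fun u v : ↥(Box d ℓ k M) => v.1 ∈ nbrs u.1) (emb y) (Γ y x))
    (hend : ∀ y x, blkWt ((ℓ + 1) ^ k) M (fun i => (ℓ + 1) ^ k * M i) y x ≠ 0 → pathEnd (emb y) (Γ y x) = x)
    (A₀ : Fin (d + 1) → ℝ) (A' : ↥(Box d ℓ k M) → ↥(Box d ℓ k M) → ℝ) :
    greenA d F κ ℓ k a m2 M emb Γ (constBond A₀ Subtype.val + A')
      = greenA0 d F κ ℓ k a m2 M emb Γ A₀
        + greenA0 d F κ ℓ k a m2 M emb Γ A₀ * pertV d F κ ℓ k a M emb Γ A₀ A'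
          * greenA d F κ ℓ k a m2 M emb Γ (constBond A₀ Subtype.val + A') :=
  B4Lemma22ReduceZero.greenA_resolvent F κ hℓ hk ha hm hM hend A₀
    (opA_isUnit_det F κ hℓ hk ha hm M hnn hend (constBond A₀ Subtype.val + A'))

/-- (2.31) for every `Ã = A₀ + A′` with [B4]'s STAIRCASE contours — no contour and no invertibility hypothesis.
[cite: Balaban1983RegularityDecay, (2.31) p. 581; (2.24) p. 580; (1.4) p. 572] -/
theorem greenA_resolvent_stair (F : OrthFlow ι) (κ : ℝ) {ℓ k : ℕ} (hℓ : 1 ≤ ℓ) (hk : 1 ≤ k)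
    (hn : 1 ≤ (ℓ + 1) ^ k) {a m2 : ℝ} (ha : 0 < a) (hm : 0 ≤ m2) {M : Fin (d + 1) → ℕ} (hM : ∀ i, 1 ≤ M i)
    (A₀ : Fin (d + 1) → ℝ) (A' : ↥(Box d ℓ k M) → ↥(Box d ℓ k M) → ℝ) :
    greenA d F κ ℓ k a m2 M (baseEmb hn M) (stairContour hn M) (constBond A₀ Subtype.val + A')
      = greenA0 d F κ ℓ k a m2 M (baseEmb hn M) (stairContour hn M) A₀
        + greenA0 d F κ ℓ k a m2 M (baseEmb hn M) (stairContour hn M) A₀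
          * pertV d F κ ℓ k a M (baseEmb hn M) (stairContour hn M) A₀ A'
          * greenA d F κ ℓ k a m2 M (baseEmb hn M) (stairContour hn M) (constBond A₀ Subtype.val + A') :=
  greenA_resolvent_all F κ hℓ hk ha hm hM (fun y x _ => stairContour_nn hn M y x)
    (fun y x h => stairContour_end hn M y x h) A₀ A'

end Lemma22

end Literature.MathematicalPhysics.QuantumFieldTheory.Balaban1983to89.B4Lemma22Invertible
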